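import Mathlib.MeasureTheory.Integral.Prod
import Mathlib.MeasureTheory.Group.Integral
import Mathlib.Analysis.SpecialFunctions.Integrals.Basic
import Mathlib.Analysis.SpecialFunctions.Trigonometric.Bounds
import Mathlib.Analysis.Calculus.Deriv.MeanValue
import Literature.NumberTheory.LFunctions.XiIntegral
import Literature.NumberTheory.LFunctions.DeBruijnHZeroProofs
import HarnessLib

/-!
# Wintner's positivity `Ξ^{(-1)}(t) > 0` and the zeros of `ξ^{(-1)}` on the critical line — proofs

Literature/NumberTheory/LFunctions; second companion ("Proofs") file of `XiIntegral.lean` (the first,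
`XiIntegralProofs.lean`, proves Lemma 3.3 (1) and the §5 horizontal bound), discharging

* `Literature.NumberTheory.LFunctions.Wintner1947_xiIntegral_im_pos` (**Wintner 1947**, as reported in
  Lagarias–Montague 2011, §2.1 and §4, proof of Thm. 2.1 (2)): `Im ξ^{(-1)}(½ + it) = Ξ^{(-1)}(t) > 0` for `t > 0`;
* `Literature.NumberTheory.LFunctions.LagariasMontague2011_thm_2_1_ii` (**Lagarias–Montague 2011, Thm. 2.1 (2)**,
  case `λ = 0`): `ξ^{(-1)}(½ + it) = 0 ↔ t = 0`.

## Proof (Lagarias–Montague 2011, §4, proof of Thm. 2.1 (2); Wintner 1947)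

The printed argument: "Wintner [Wi47] proved that `Ξ₀^{(-1)}(t) > 0` when `t > 0`; this fact together with the
functional equation implies that `ξ^{(-1)}(s)` has no zeros on the critical line except for a zero at `s = ½`",
and Wintner's proof is the *Claim* of LM §4: if `Ψ` is positive and decreasing on `(0, ∞)` then
`∫₀^∞ Ψ(u) (sin tu / u) du > 0` (pair the humps of `sin`), applied to Riemann's kernel `Φ` in
`Ξ^{(-1)}(t) = 2 ∫₀^∞ Φ(u) (sin tu / u) du` (LM eq. (1.4)). We follow it with the tree's objects:

1. (`xiIntegral_eq_integral_sin`) Riemann's representation `ξ(½ + ix) = 8 H₀(2x) = 8 ∫₀^∞ Φ(v) cos(2xv) dv`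
   is the tree's `deBruijnH_zero_eq_holds` (`DeBruijnHZeroProofs.lean`, `Φ = deBruijnPhi`, Rodgers–Tao
   normalisation); Fubini over `[0,1] × (0,∞)` and `∫₀¹ cos(2utv) du = sin(2tv)/(2tv)` give
   `ξ^{(-1)}(½ + it) = 4i ∫₀^∞ (Φ(v)/v) sin(2tv) dv`.
2. (`deBruijnPhi_div_lt`) DEVIATION from the letter of LM: the pairing argument only uses that `Ψ(u)/u` is
   decreasing (LM write `ψ(u) = Ψ(u)/u … decreases`), and for `Ψ = Φ` this weaker property is termwise
   elementary — `u Φₙ'(u) < Φₙ(u)` for `u > 0` reduces to `2Y − 3 + u(8Y² − 30Y + 15) > 0` with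
   `Y = π(n+1)²e^{4u} > 3` — whereas the monotonicity of `Φ` itself (Wintner 1935, LM Lemma 3.1 (5)) needs the
   theta functional equation near `u = 0`. So we prove `Φ(u)/u` strictly decreasing and use only that.
3. (`setIntegral_Ioi_mul_sin_pos`) Wintner's claim: for `ψ` strictly decreasing on `(0,∞)` and `a > 0`, with
   `ψ(v) sin(av)` integrable, `∫₀^∞ ψ(v) sin(av) dv > 0`: split `(0,∞)` into `E = {sin(av) > 0}`,
   `O = {sin(av) < 0} = E + π/a` and a null set; `∫_O = ∫_E ψ(v + π/a) sin(av + π) dv`, so the total is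
   `∫_E (ψ(v) − ψ(v + π/a)) sin(av) dv > 0`.
4. (`xiIntegral_one_sub`) `ξ^{(-1)}(1 − s) = −ξ^{(-1)}(s)` from `ξ(1 − s) = ξ(s)` (LM eq. (1.3)); with 1.–3. this
   gives both discharges.

No new definitions or named facts are introduced.

## References

* J. C. Lagarias, D. Montague, *The integral of the Riemann ξ-function*, Comment. Math. Univ. St. Pauli 60
  (2011), 143–169; arXiv:1106.4348 — §1 eq. (1.3)–(1.4), §2.1, Thm. 2.1 (2), §4 (proof of Thm. 2.1 (2) and
  its Claim). [LagariasMontague2011]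
* A. Wintner, *On an oscillatory property of the Riemann Ξ-function*, Math. Notae 7 (1947), 177–178. [Wintner1947]
* E. C. Titchmarsh, *The Theory of the Riemann Zeta-Function*, 2nd ed. (1986), §10.1. [Titchmarsh1986]
-/

noncomputable section

open Complex MeasureTheory Real Set Filter
open scoped Topology

namespace Literature.NumberTheory.LFunctions

/-! ## 1. The kernel: `Φ(u)/u` is strictly decreasing on `(0, ∞)` -/

/-- The elementary inequality behind `u Φₙ'(u) < Φₙ(u)`: for `Y > 3`, `u > 0` and (`u ≤ 1` or `Y > 15`),
`0 < 2Y − 3 + u (8Y² − 30Y + 15)` (on `Y ≥ 3`, `8Y² − 30Y + 15 ≥ −3`; for `Y > 15` it is positive). [folklore] -/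
theorem wintner_poly_pos {Y u : ℝ} (hY : 3 < Y) (hu : 0 < u) (h : u ≤ 1 ∨ 15 < Y) :
    0 < 2 * Y - 3 + u * (8 * Y ^ 2 - 30 * Y + 15) := by
  have hq : -3 ≤ 8 * Y ^ 2 - 30 * Y + 15 := by nlinarith
  rcases h with hu1 | hY15
  · rcases le_or_gt 0 (8 * Y ^ 2 - 30 * Y + 15) with hc | hc
    · nlinarith
    · -- `u c ≥ c ≥ -3` for `c < 0`, `0 < u ≤ 1`
      nlinarith
  · have hc : 0 < 8 * Y ^ 2 - 30 * Y + 15 := by nlinarith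
    nlinarith

/-- Each summand `Φₙ` of `Φ = deBruijnPhi` is differentiable, and for `u > 0` its derivative satisfies
`u Φₙ'(u) < Φₙ(u)`: with `a = eᵘ`, `Y = π(n+1)²a⁴`, one has
`Φₙ(u) − u Φₙ'(u) = e^{−Y} a Y (2Y − 3 + u(8Y² − 30Y + 15)) > 0`. [folklore] -/
theorem exists_hasDerivAt_deBruijnPhiSummand (n : ℕ) {u : ℝ} (hu : 0 < u) :
    ∃ D : ℝ, HasDerivAt (deBruijnPhiSummand n) D u ∧ u * D < deBruijnPhiSummand n u := by
  have h9 : HasDerivAt (fun y : ℝ ↦ rexp (9 * y)) (rexp (9 * u) * (9 * 1)) u :=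
    ((hasDerivAt_id u).const_mul 9).exp
  have h5 : HasDerivAt (fun y : ℝ ↦ rexp (5 * y)) (rexp (5 * u) * (5 * 1)) u :=
    ((hasDerivAt_id u).const_mul 5).exp
  have h4 : HasDerivAt (fun y : ℝ ↦ rexp (4 * y)) (rexp (4 * u) * (4 * 1)) u :=
    ((hasDerivAt_id u).const_mul 4).exp
  have hP : HasDerivAt (fun y : ℝ ↦ 2 * π ^ 2 * ((n : ℝ) + 1) ^ 4 * rexp (9 * y) -
      3 * π * ((n : ℝ) + 1) ^ 2 * rexp (5 * y))
      (2 * π ^ 2 * ((n : ℝ) + 1) ^ 4 * (rexp (9 * u) * (9 * 1)) -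
        3 * π * ((n : ℝ) + 1) ^ 2 * (rexp (5 * u) * (5 * 1))) u :=
    (h9.const_mul _).sub (h5.const_mul _)
  have hE : HasDerivAt (fun y : ℝ ↦ rexp (-(π * ((n : ℝ) + 1) ^ 2 * rexp (4 * y))))
      (rexp (-(π * ((n : ℝ) + 1) ^ 2 * rexp (4 * u))) *
        (-(π * ((n : ℝ) + 1) ^ 2 * (rexp (4 * u) * (4 * 1))))) u :=
    ((h4.const_mul _).neg).exp
  refine ⟨_, hP.mul hE, ?_⟩
  -- the inequality
  set m : ℝ := (n : ℝ) + 1 with hm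
  have hm1 : 1 ≤ m := by simp [hm]
  set a : ℝ := rexp u with ha
  have ha0 : 0 < a := Real.exp_pos u
  have ha1 : 1 < a := Real.one_lt_exp_iff.mpr hu
  have h4' : rexp (4 * u) = a ^ 4 := by rw [ha, ← Real.exp_nat_mul]; norm_num
  have h5' : rexp (5 * u) = a ^ 5 := by rw [ha, ← Real.exp_nat_mul]; norm_num
  have h9' : rexp (9 * u) = a ^ 9 := by rw [ha, ← Real.exp_nat_mul]; norm_num
  simp only [deBruijnPhiSummand]
  rw [h4', h5', h9']
  have hE0 : 0 < rexp (-(π * m ^ 2 * a ^ 4)) := Real.exp_pos _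
  have ha4 : 1 < a ^ 4 := one_lt_pow₀ ha1 (by norm_num)
  have hm2 : 1 ≤ m ^ 2 := one_le_pow₀ hm1
  have hY3 : 3 < π * m ^ 2 * a ^ 4 := by
    have h1 : 3 < π * m ^ 2 := by nlinarith [Real.pi_gt_three, Real.pi_pos]
    nlinarith [Real.pi_pos]
  have hY0 : 0 < π * m ^ 2 * a ^ 4 := by linarith
  have key : 0 < 2 * (π * m ^ 2 * a ^ 4) - 3 +
      u * (8 * (π * m ^ 2 * a ^ 4) ^ 2 - 30 * (π * m ^ 2 * a ^ 4) + 15) := by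
    refine wintner_poly_pos hY3 hu ?_
    rcases le_or_gt u 1 with hu1 | hu1
    · exact Or.inl hu1
    · refine Or.inr ?_
      -- `u > 1`: `a = eᵘ > e > 2`, so `a⁴ > 16` and `Y > 3 · 16 > 15`
      have ha2 : 2 < a := by
        have := Real.add_one_le_exp u; linarith
      have ha16 : 16 < a ^ 4 := by
        have := pow_lt_pow_left₀ ha2 (by norm_num) (show (4 : ℕ) ≠ 0 by norm_num)
        norm_num at this
        exact this
      have h1 : 3 ≤ π * m ^ 2 := by nlinarith [Real.pi_gt_three, Real.pi_pos]
      nlinarith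
  have expand : (2 * π ^ 2 * m ^ 4 * a ^ 9 - 3 * π * m ^ 2 * a ^ 5) * rexp (-(π * m ^ 2 * a ^ 4)) -
      u * ((2 * π ^ 2 * m ^ 4 * (a ^ 9 * (9 * 1)) - 3 * π * m ^ 2 * (a ^ 5 * (5 * 1))) *
        rexp (-(π * m ^ 2 * a ^ 4)) + (2 * π ^ 2 * m ^ 4 * a ^ 9 - 3 * π * m ^ 2 * a ^ 5) *
        (rexp (-(π * m ^ 2 * a ^ 4)) * -(π * m ^ 2 * (a ^ 4 * (4 * 1))))) =
      rexp (-(π * m ^ 2 * a ^ 4)) * a * (π * m ^ 2 * a ^ 4) *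
        (2 * (π * m ^ 2 * a ^ 4) - 3 +
          u * (8 * (π * m ^ 2 * a ^ 4) ^ 2 - 30 * (π * m ^ 2 * a ^ 4) + 15)) := by
    ring
  have hpos : 0 < rexp (-(π * m ^ 2 * a ^ 4)) * a * (π * m ^ 2 * a ^ 4) *
      (2 * (π * m ^ 2 * a ^ 4) - 3 +
        u * (8 * (π * m ^ 2 * a ^ 4) ^ 2 - 30 * (π * m ^ 2 * a ^ 4) + 15)) :=
    mul_pos (mul_pos (mul_pos hE0 ha0) hY0) key
  linarith [expand]

/-- For each `n`, `u ↦ Φₙ(u)/u` is strictly decreasing on `(0, ∞)` (its derivative is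
`(u Φₙ' − Φₙ)/u² < 0`). [folklore] -/
theorem strictAntiOn_deBruijnPhiSummand_div (n : ℕ) :
    StrictAntiOn (fun u : ℝ ↦ deBruijnPhiSummand n u / u) (Ioi 0) := by
  refine strictAntiOn_of_deriv_neg (convex_Ioi 0) ?_ fun u hu ↦ ?_
  · exact (continuous_deBruijnPhiSummand n).continuousOn.div continuousOn_id fun x hx ↦ ne_of_gt hx
  · rw [interior_Ioi] at hu
    have hu0 : (0 : ℝ) < u := hu
    obtain ⟨D, hD, hlt⟩ := exists_hasDerivAt_deBruijnPhiSummand n hu0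
    have hq : HasDerivAt (fun y : ℝ ↦ deBruijnPhiSummand n y / y)
        ((D * u - deBruijnPhiSummand n u * 1) / u ^ 2) u := hD.fun_div (hasDerivAt_id u) hu0.ne'
    rw [hq.deriv]
    refine div_neg_of_neg_of_pos ?_ (by positivity)
    nlinarith

/-- `Φ(u)/u` is strictly decreasing on `(0, ∞)`: for `0 < u < v`, `Φ(v)/v < Φ(u)/u`
(the only property of `Φ` used in Wintner's pairing argument). [folklore] -/
theorem deBruijnPhi_div_lt {u v : ℝ} (hu : 0 < u) (huv : u < v) :
    deBruijnPhi v / v < deBruijnPhi u / u := by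
  have hv : 0 < v := hu.trans huv
  rw [deBruijnPhi, deBruijnPhi, ← tsum_div_const, ← tsum_div_const]
  refine Summable.tsum_lt_tsum (i := 0) (fun n ↦ ?_) ?_
    ((summable_deBruijnPhi_holds v).div_const v) ((summable_deBruijnPhi_holds u).div_const u)
  · exact ((strictAntiOn_deBruijnPhiSummand_div n) hu hv huv).le
  · exact (strictAntiOn_deBruijnPhiSummand_div 0) hu hv huv

/-- `Φ` is integrable on `(0, ∞)` (from the tree's dominating-function bound with `T = Y = 0`). [folklore] -/
theorem integrableOn_deBruijnPhi_Ioi : IntegrableOn deBruijnPhi (Ioi 0) := by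
  have h := integrableOn_deBruijnHBound 0 0
  have h' : IntegrableOn (fun u ↦ |deBruijnPhi u|) (Ioi 0) := by
    refine h.congr_fun (fun u _ ↦ ?_) measurableSet_Ioi
    simp [deBruijnHBound]
  exact (integrable_norm_iff
    (continuous_deBruijnPhi.aestronglyMeasurable.restrict)).mp h'

/-! ## 2. Wintner's claim: `∫₀^∞ ψ(v) sin(av) dv > 0` for `ψ` strictly decreasing -/

/-- **Wintner's claim** (Lagarias–Montague 2011, §4, Claim; Wintner 1947), in the form actually used: if `ψ`
is strictly decreasing on `(0, ∞)`, `a > 0`, and `v ↦ ψ(v) sin(av)` is integrable on `(0, ∞)`, then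
`∫₀^∞ ψ(v) sin(av) dv > 0`. Proof: with `p = π/a`, `E = {v > 0 : sin av > 0}` and `O = {v > 0 : sin av < 0}
= E + p`, one has `∫_O ψ(v) sin(av) dv = −∫_E ψ(v+p) sin(av) dv`, so the integral equals
`∫_E (ψ(v) − ψ(v+p)) sin(av) dv > 0`. [cite: LagariasMontague2011, §4 (Claim)] -/
theorem setIntegral_Ioi_mul_sin_pos {ψ : ℝ → ℝ} {a : ℝ} (ha : 0 < a)
    (hψ : StrictAntiOn ψ (Ioi 0))
    (hint : IntegrableOn (fun v ↦ ψ v * Real.sin (a * v)) (Ioi 0)) :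
    0 < ∫ v in Ioi (0 : ℝ), ψ v * Real.sin (a * v) := by
  set h : ℝ → ℝ := fun v ↦ ψ v * Real.sin (a * v) with hh
  set p : ℝ := π / a with hp
  have hp0 : 0 < p := div_pos Real.pi_pos ha
  have hap : a * p = π := by rw [hp]; field_simp
  have hshift : ∀ v : ℝ, Real.sin (a * (v + p)) = -Real.sin (a * v) := fun v ↦ by
    rw [mul_add, hap, Real.sin_add_pi]
  set E : Set ℝ := Ioi 0 ∩ {v | 0 < Real.sin (a * v)} with hE
  set O : Set ℝ := Ioi 0 ∩ {v | Real.sin (a * v) < 0} with hO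
  set Z : Set ℝ := Ioi 0 ∩ {v | Real.sin (a * v) = 0} with hZ
  have hcont : Continuous fun v : ℝ ↦ Real.sin (a * v) := by fun_prop
  have hEm : MeasurableSet E :=
    measurableSet_Ioi.inter (measurableSet_lt measurable_const hcont.measurable)
  have hOm : MeasurableSet O :=
    measurableSet_Ioi.inter (measurableSet_lt hcont.measurable measurable_const)
  have hZm : MeasurableSet Z :=
    measurableSet_Ioi.inter (measurableSet_eq_fun hcont.measurable measurable_const)
  -- the decomposition `(0,∞) = (E ∪ O) ∪ Z`
  have hsplit : Ioi (0 : ℝ) = (E ∪ O) ∪ Z := by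
    ext v
    simp only [hE, hO, hZ, mem_union, mem_inter_iff, mem_Ioi, mem_setOf_eq]
    constructor
    · intro hv
      rcases lt_trichotomy 0 (Real.sin (a * v)) with hs | hs | hs
      · exact Or.inl (Or.inl ⟨hv, hs⟩)
      · exact Or.inr ⟨hv, hs.symm⟩
      · exact Or.inl (Or.inr ⟨hv, hs⟩)
    · rintro ((⟨hv, -⟩ | ⟨hv, -⟩) | ⟨hv, -⟩) <;> exact hv
  have hdisj1 : Disjoint (E ∪ O) Z := by
    refine Set.disjoint_left.2 fun v hv hz ↦ ?_
    rcases hv with ⟨-, hs⟩ | ⟨-, hs⟩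
    · exact (ne_of_gt (show 0 < Real.sin (a * v) from hs)) hz.2
    · exact (ne_of_lt (show Real.sin (a * v) < 0 from hs)) hz.2
  have hdisj2 : Disjoint E O := by
    refine Set.disjoint_left.2 fun v hv ho ↦ ?_
    exact lt_asymm (show 0 < Real.sin (a * v) from hv.2) ho.2
  -- `Z` is countable, hence null
  have hZ0 : volume Z = 0 := by
    refine Countable.measure_zero ?_ volume
    have : Z ⊆ Set.range fun k : ℤ ↦ (k : ℝ) * π / a := by
      rintro v ⟨-, hv⟩
      obtain ⟨k, hk⟩ := Real.sin_eq_zero_iff.1 (show Real.sin (a * v) = 0 from hv)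
      refine ⟨k, ?_⟩
      show (k : ℝ) * π / a = v
      rw [hk]
      field_simp
    exact (Set.countable_range _).mono this
  have hEsub : E ⊆ Ioi 0 := inter_subset_left
  have hOsub : O ⊆ Ioi 0 := inter_subset_left
  have hintE : IntegrableOn h E := hint.mono_set hEsub
  have hintO : IntegrableOn h O := hint.mono_set hOsub
  have hintZ : IntegrableOn h Z := hint.mono_set inter_subset_left
  have htot : ∫ v in Ioi (0 : ℝ), h v = (∫ v in E, h v) + ∫ v in O, h v := by
    rw [hsplit, setIntegral_union hdisj1 hZm (hintE.union hintO) hintZ,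
      setIntegral_measure_zero _ hZ0, add_zero, setIntegral_union hdisj2 hOm hintE hintO]
  -- `O = E + p`
  have hpre : (fun v ↦ v + p) ⁻¹' O = E := by
    ext v
    simp only [hO, hE, mem_preimage, mem_inter_iff, mem_Ioi, mem_setOf_eq, hshift v]
    constructor
    · rintro ⟨hvp, hs⟩
      have hs' : 0 < Real.sin (a * v) := by linarith
      refine ⟨?_, hs'⟩
      by_contra hv0
      replace hv0 : v ≤ 0 := not_lt.1 hv0
      have h1 : -π ≤ a * v := by
        have := mul_lt_mul_of_pos_left (show -p < v by linarith) ha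
        rw [mul_neg, hap] at this
        exact this.le
      have h2 : a * v ≤ 0 := mul_nonpos_of_nonneg_of_nonpos ha.le hv0
      exact absurd (Real.sin_nonpos_of_nonpos_of_neg_pi_le h2 h1) (not_le.2 hs')
    · rintro ⟨hv, hs⟩
      exact ⟨by linarith, by linarith⟩
  have hO_eq : ∫ v in O, h v = ∫ v in E, h (v + p) := by
    rw [← integral_indicator hOm, ← integral_indicator hEm,
      ← integral_add_right_eq_self (O.indicator h) p]
    congr 1
    funext x
    rw [← hpre]
    exact (indicator_comp_right (fun v ↦ v + p)).symm
  have hintE' : IntegrableOn (fun v ↦ h (v + p)) E := by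
    rw [← integrable_indicator_iff hEm]
    have := ((integrable_indicator_iff hOm).2 hintO).comp_add_right p
    refine this.congr (ae_of_all _ fun x ↦ ?_)
    rw [← hpre]
    exact (indicator_comp_right (fun v ↦ v + p)).symm
  -- positivity on `E`
  have hg_pos : ∀ v ∈ E, 0 < (ψ v - ψ (v + p)) * Real.sin (a * v) := by
    rintro v ⟨hv, hs⟩
    have hv0 : (0 : ℝ) < v := hv
    exact mul_pos (sub_pos.2 (hψ hv (show (0 : ℝ) < v + p by linarith) (by linarith))) hs
  have hsum : (∫ v in E, h v) + ∫ v in E, h (v + p) =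
      ∫ v in E, (ψ v - ψ (v + p)) * Real.sin (a * v) := by
    rw [← integral_add hintE hintE']
    refine setIntegral_congr_fun hEm fun v _ ↦ ?_
    simp only [hh, hshift v]
    ring
  have hintg : IntegrableOn (fun v ↦ (ψ v - ψ (v + p)) * Real.sin (a * v)) E := by
    refine (hintE.add hintE').congr_fun (fun v _ ↦ ?_) hEm
    simp only [hh, hshift v, Pi.add_apply]
    ring
  have hpos : 0 < ∫ v in E, (ψ v - ψ (v + p)) * Real.sin (a * v) := by
    rw [setIntegral_pos_iff_support_of_nonneg_ae
      (ae_restrict_of_forall_mem hEm fun v hv ↦ (hg_pos v hv).le) hintg]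
    have hsub : Ioo 0 p ⊆ (Function.support fun v ↦ (ψ v - ψ (v + p)) * Real.sin (a * v)) ∩ E := by
      intro v hv
      have hvE : v ∈ E := by
        refine ⟨hv.1, ?_⟩
        change 0 < Real.sin (a * v)
        refine Real.sin_pos_of_pos_of_lt_pi (mul_pos ha hv.1) ?_
        calc a * v < a * p := mul_lt_mul_of_pos_left hv.2 ha
          _ = π := hap
      exact ⟨Function.mem_support.2 (hg_pos v hvE).ne', hvE⟩
    refine lt_of_lt_of_le ?_ (measure_mono hsub)
    rw [Real.volume_Ioo]
    exact ENNReal.ofReal_pos.2 (by linarith)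
  rw [htot, hO_eq, hsum]
  exact hpos

/-! ## 3. `ξ^{(-1)}(½ + it) = 4i ∫₀^∞ (Φ(v)/v) sin(2tv) dv` -/

/-- Riemann's representation on the critical line, through the tree's `H₀ = Ξ(·/2)/8`
(`deBruijnH_zero_eq_holds`): `ξ(½ + i u t) = 8 ∫₀^∞ Φ(v) cos(u · 2tv) dv` for real `u, t`.
[cite: Titchmarsh1986, §10.1] -/
theorem riemannXi_half_add_eq_integral_cos (u t : ℝ) :
    riemannXi (1 / 2 + (u : ℂ) * ((t : ℂ) * I)) =
      8 * ((∫ v in Ioi (0 : ℝ), deBruijnPhi v * Real.cos (u * (2 * t * v)) : ℝ) : ℂ) := by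
  have h := deBruijnH_zero_eq_holds ((2 * u * t : ℝ) : ℂ)
  have harg : (1 / 2 + I * ((2 * u * t : ℝ) : ℂ) / 2 : ℂ) = 1 / 2 + (u : ℂ) * ((t : ℂ) * I) := by
    push_cast; ring
  rw [harg] at h
  have hH : deBruijnH 0 ((2 * u * t : ℝ) : ℂ) =
      ((∫ v in Ioi (0 : ℝ), deBruijnPhi v * Real.cos (u * (2 * t * v)) : ℝ) : ℂ) := by
    rw [deBruijnH, ← integral_complex_ofReal]
    refine setIntegral_congr_fun measurableSet_Ioi fun v _ ↦ ?_
    have hcos : Complex.cos (((2 * u * t : ℝ) : ℂ) * (v : ℂ)) = ((Real.cos (u * (2 * t * v)) : ℝ) : ℂ) := by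
      rw [Complex.ofReal_cos]
      congr 1
      push_cast
      ring
    rw [hcos, zero_mul, Real.exp_zero, Complex.ofReal_one, one_mul, ← Complex.ofReal_mul]
  rw [← hH, h]
  ring

/-- Fubini and `∫₀¹ cos(2utv) du = sin(2tv)/(2tv)` (`t ≠ 0`):
`∫₀¹ (∫₀^∞ Φ(v) cos(2utv) dv) du = ∫₀^∞ Φ(v) sin(2tv)/(2tv) dv`. [folklore] -/
theorem integral_integral_deBruijnPhi_cos {t : ℝ} (ht : t ≠ 0) :
    ∫ u in (0 : ℝ)..1, (∫ v in Ioi (0 : ℝ), deBruijnPhi v * Real.cos (u * (2 * t * v))) =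
      ∫ v in Ioi (0 : ℝ), deBruijnPhi v * (Real.sin (2 * t * v) / (2 * t * v)) := by
  have hΦ : Integrable (fun v ↦ deBruijnPhi v) (volume.restrict (Ioi (0 : ℝ))) :=
    integrableOn_deBruijnPhi_Ioi
  rw [intervalIntegral.integral_of_le zero_le_one]
  have hF : Integrable (Function.uncurry fun (u v : ℝ) ↦ deBruijnPhi v * Real.cos (u * (2 * t * v)))
      ((volume.restrict (Ioc (0 : ℝ) 1)).prod (volume.restrict (Ioi (0 : ℝ)))) := by
    have h1 : Integrable (fun _ : ℝ ↦ (1 : ℝ)) (volume.restrict (Ioc (0 : ℝ) 1)) := integrable_const 1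
    have h2 := h1.mul_prod hΦ
    refine h2.mono' ?_ (ae_of_all _ ?_)
    · have hc : Continuous (Function.uncurry fun (u v : ℝ) ↦ deBruijnPhi v * Real.cos (u * (2 * t * v))) :=
        (continuous_deBruijnPhi.comp continuous_snd).mul
          (Real.continuous_cos.comp (continuous_fst.mul (continuous_const.mul continuous_snd)))
      exact hc.aestronglyMeasurable
    · rintro ⟨u, v⟩
      simp only [Function.uncurry_apply_pair, one_mul, Real.norm_eq_abs, abs_mul]
      have := Real.abs_cos_le_one (u * (2 * t * v))
      have h0 : 0 ≤ |deBruijnPhi v| := abs_nonneg _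
      calc |deBruijnPhi v| * |Real.cos (u * (2 * t * v))| ≤ |deBruijnPhi v| * 1 := by gcongr
        _ = deBruijnPhi v := by rw [mul_one, abs_of_pos (deBruijnPhi_pos_holds v)]
  rw [integral_integral_swap hF]
  refine setIntegral_congr_fun measurableSet_Ioi fun v hv ↦ ?_
  have hv0 : (0 : ℝ) < v := hv
  have hc : 2 * t * v ≠ 0 := mul_ne_zero (mul_ne_zero two_ne_zero ht) hv0.ne'
  rw [integral_const_mul, ← intervalIntegral.integral_of_le zero_le_one,
    intervalIntegral.integral_comp_mul_right (fun x ↦ Real.cos x) hc, integral_cos]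
  simp only [zero_mul, one_mul, Real.sin_zero, sub_zero, smul_eq_mul]
  ring

/-- `ξ^{(-1)}(½ + it) = 4i · ∫₀^∞ (Φ(v)/v) sin(2tv) dv` for real `t ≠ 0` (Lagarias–Montague 2011, eq. (1.4):
`Ξ^{(-1)}(z) = 2∫₀^∞ Φ_LM(u) (sin zu/u) du`, `Φ_LM(u) = 2Φ(u/2)`). [cite: LagariasMontague2011, eq. (1.4)] -/
theorem xiIntegral_eq_integral_sin {t : ℝ} (ht : t ≠ 0) :
    xiIntegral (1 / 2 + t * I) =
      4 * ((∫ v in Ioi (0 : ℝ), deBruijnPhi v / v * Real.sin (2 * t * v) : ℝ) : ℂ) * I := by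
  set W : ℝ := ∫ v in Ioi (0 : ℝ), deBruijnPhi v / v * Real.sin (2 * t * v) with hW
  have hs : (1 / 2 + (t : ℂ) * I - 1 / 2 : ℂ) = (t : ℂ) * I := by ring
  rw [xiIntegral, hs]
  have h1 : ∫ u in (0 : ℝ)..1, riemannXi (1 / 2 + (u : ℂ) * ((t : ℂ) * I)) =
      8 * (((∫ u in (0 : ℝ)..1, ∫ v in Ioi (0 : ℝ), deBruijnPhi v * Real.cos (u * (2 * t * v)) : ℝ)) : ℂ) := by
    simp_rw [riemannXi_half_add_eq_integral_cos]
    rw [intervalIntegral.integral_const_mul, intervalIntegral.integral_ofReal]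
  have h2 : ∫ v in Ioi (0 : ℝ), deBruijnPhi v * (Real.sin (2 * t * v) / (2 * t * v)) = (2 * t)⁻¹ * W := by
    rw [hW, ← integral_const_mul]
    refine setIntegral_congr_fun measurableSet_Ioi fun v _ ↦ ?_
    ring
  rw [h1, integral_integral_deBruijnPhi_cos ht, h2]
  have htc : (t : ℂ) ≠ 0 := ofReal_ne_zero.mpr ht
  push_cast
  field_simp
  ring

/-- `Im ξ^{(-1)}(½ + it) = 4 ∫₀^∞ (Φ(v)/v) sin(2tv) dv` (`t ≠ 0`); i.e. `Ξ₀^{(-1)}(t) = 2∫₀^∞ Φ_LM (sin tu/u) du`.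
[cite: LagariasMontague2011, eq. (1.4)] -/
theorem im_xiIntegral_eq {t : ℝ} (ht : t ≠ 0) :
    (xiIntegral (1 / 2 + t * I)).im = 4 * ∫ v in Ioi (0 : ℝ), deBruijnPhi v / v * Real.sin (2 * t * v) := by
  rw [xiIntegral_eq_integral_sin ht]
  simp

/-- Integrability of `v ↦ (Φ(v)/v) sin(av)` on `(0, ∞)`: `|sin(av)|/v ≤ a`. [folklore] -/
theorem integrableOn_deBruijnPhi_div_mul_sin {a : ℝ} (ha : 0 < a) :
    IntegrableOn (fun v ↦ deBruijnPhi v / v * Real.sin (a * v)) (Ioi 0) := by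
  have hg : IntegrableOn (fun v ↦ a * deBruijnPhi v) (Ioi 0) := integrableOn_deBruijnPhi_Ioi.const_mul a
  refine hg.mono' ?_ (ae_restrict_of_forall_mem measurableSet_Ioi fun v hv ↦ ?_)
  · refine ContinuousOn.aestronglyMeasurable ?_ measurableSet_Ioi
    refine (continuous_deBruijnPhi.continuousOn.div continuousOn_id fun x hx ↦ ne_of_gt hx).mul ?_
    exact (by fun_prop : Continuous fun v : ℝ ↦ Real.sin (a * v)).continuousOn
  · have hv0 : (0 : ℝ) < v := hv
    have hΦ := deBruijnPhi_pos_holds v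
    rw [Real.norm_eq_abs, abs_mul, abs_div, abs_of_pos hΦ, abs_of_pos hv0]
    have hsin : |Real.sin (a * v)| ≤ a * v := by
      refine (Real.abs_sin_le_abs).trans ?_
      rw [abs_of_pos (mul_pos ha hv0)]
    calc deBruijnPhi v / v * |Real.sin (a * v)| ≤ deBruijnPhi v / v * (a * v) := by gcongr
      _ = a * deBruijnPhi v := by field_simp

/-! ## 4. The discharges -/

/-- The functional equation of the integral: `ξ^{(-1)}(1 − s) = −ξ^{(-1)}(s)` (Lagarias–Montague 2011,
eq. (1.3)), from `ξ(1 − s) = ξ(s)`. [cite: LagariasMontague2011, eq. (1.3)] -/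
theorem xiIntegral_one_sub (s : ℂ) : xiIntegral (1 - s) = -xiIntegral s := by
  rw [xiIntegral, xiIntegral]
  have h : ∀ u : ℝ, riemannXi (1 / 2 + (u : ℂ) * (1 - s - 1 / 2)) = riemannXi (1 / 2 + (u : ℂ) * (s - 1 / 2)) := by
    intro u
    rw [← riemannXi_one_sub (1 / 2 + (u : ℂ) * (s - 1 / 2))]
    congr 1
    ring
  simp_rw [h]
  ring

/-- **Discharge** of `Literature.NumberTheory.LFunctions.Wintner1947_xiIntegral_im_pos` (**Wintner 1947**;
Lagarias–Montague 2011, §4, proof of Thm. 2.1 (2): "Wintner [Wi47] proved directly that `Ξ₀^{(-1)}(t) > 0` when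
`t > 0`"): `Ξ₀^{(-1)}(t) = Im ξ^{(-1)}(½ + it) > 0` for `t > 0` — Wintner's pairing claim applied to
`ψ = Φ(v)/v` (strictly decreasing) in `Im ξ^{(-1)}(½ + it) = 4∫₀^∞ (Φ(v)/v) sin(2tv) dv`.
[cite: Wintner1947, Thm. (via LagariasMontague2011 §4, proof of Thm. 2.1 (2))] -/
theorem Wintner1947_xiIntegral_im_pos_holds : Wintner1947_xiIntegral_im_pos := by
  intro t ht
  rw [im_xiIntegral_eq ht.ne']
  refine mul_pos (by norm_num) ?_
  have h2t : 0 < 2 * t := by linarith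
  have hanti : StrictAntiOn (fun v : ℝ ↦ deBruijnPhi v / v) (Ioi 0) :=
    fun u hu v _ huv ↦ deBruijnPhi_div_lt hu huv
  simpa using setIntegral_Ioi_mul_sin_pos h2t hanti (integrableOn_deBruijnPhi_div_mul_sin h2t)

/-- **Discharge** of `Literature.NumberTheory.LFunctions.LagariasMontague2011_thm_2_1_ii` (**Lagarias–Montague
2011, Thm. 2.1 (2)**, case `λ = 0`): on the critical line, `ξ^{(-1)}(½ + it) = 0 ↔ t = 0` — by Wintner's
positivity for `t > 0`, the functional equation `ξ^{(-1)}(1 − s) = −ξ^{(-1)}(s)` for `t < 0`, and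
`ξ^{(-1)}(½) = 0`. [cite: LagariasMontague2011, Thm. 2.1 (2)] -/
theorem LagariasMontague2011_thm_2_1_ii_holds : LagariasMontague2011_thm_2_1_ii := by
  intro t
  constructor
  · intro h
    by_contra ht
    rcases lt_or_gt_of_ne ht with hneg | hpos
    · have hW := Wintner1947_xiIntegral_im_pos_holds (-t) (by linarith)
      have hodd : xiIntegral (1 / 2 + ((-t : ℝ) : ℂ) * I) = -xiIntegral (1 / 2 + (t : ℂ) * I) := by
        rw [← xiIntegral_one_sub]
        congr 1
        push_cast
        ring
      rw [hodd, h, neg_zero] at hW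
      simp at hW
    · have hW := Wintner1947_xiIntegral_im_pos_holds t hpos
      rw [h] at hW
      simp at hW
  · rintro rfl
    simp [xiIntegral]

end Literature.NumberTheory.LFunctions

end
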